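import Literature.Combinatorics.Sahi2008.Multilinear

/-!
# Sahi (2008): reduction of `E_n ≥ 0` to indicator functions of up-sets (layer cake)

CITATION HEADER.  Source of the argument: [LiebSahi2021, Lemma 2.2] ("It suffices to prove Theorem 2.1 for
`χ_S, χ_T, χ_U`, for all monotone `S, T, U`.  Proof: Any positive `f` can be written as an integral over the
characteristic functions of its upper level sets … If `f` is monotone, then `ξ_s` is monotone for every `s`.  Since
`E_3` is multi-linear in `f, g, h`, this reduces [the inequality] to the case of monotone characteristic functions");
the same remark for rectangles [LiebSahi2021, §3.3, after Thm. 3.5] and for cumulations [Sahi2008, p. 211].  Here, on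
a FINITE preorder, the layer cake is a finite sum: every nonnegative monotone `f` is a nonnegative combination of
indicators of up-sets (`exists_upperSet_decomposition`, peeling the least positive value), and by multilinearity
(`Sahi2008/Multilinear.lean`) order-`n` Sahi positivity of a weight is EQUIVALENT to `E_n ≥ 0` on `n`-tuples of
indicators of up-sets (`sahiPositive_iff_indicators`) — e.g. Kahn's three-up-sets form of `C_3` for a product
measure [Kahn2022, Conj. 5] is the whole of `C_3` for that measure.  Everything here is proved.
-/

namespace Literature.Combinatorics.Sahi2008

open Finset Function

variable {α : Type*}

/-! ### Indicators of finite sets -/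

section Indicator

variable [DecidableEq α]

/-- The real indicator function `1_A` of a finite set (Lieb–Sahi's characteristic function `χ_S`; a plumbing
def). [cite: LiebSahi2021, §2 before Lemma 2.2 (characteristic functions χ_S; S monotone iff χ_S monotone)] -/
def setInd (A : Finset α) : α → ℝ := fun x => if x ∈ A then 1 else 0

/-- Unfolding `setInd`: `χ_S(x) = 1` if `x ∈ S` and `0` otherwise. [cite: LiebSahi2021, §2 before Lemma 2.2 (characteristic functions χ_S; S monotone iff χ_S monotone)] -/
theorem setInd_apply (A : Finset α) (x : α) : setInd A x = if x ∈ A then 1 else 0 := rfl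

/-- `χ_A · χ_B = χ_{A ∩ B}`. [cite: LiebSahi2021, §2 before Lemma 2.2 (characteristic functions χ_S; S monotone iff χ_S monotone)] -/
theorem setInd_mul (A B : Finset α) : setInd A * setInd B = setInd (A ∩ B) := by
  funext x
  simp only [Pi.mul_apply, setInd_apply, Finset.mem_inter]
  by_cases hA : x ∈ A <;> by_cases hB : x ∈ B <;> simp [hA, hB]

/-- `χ_A ≥ 0` (characteristic functions are positive functions). [cite: LiebSahi2021, §2 before Lemma 2.2 (characteristic functions χ_S; S monotone iff χ_S monotone)] -/
theorem setInd_nonneg (A : Finset α) (x : α) : 0 ≤ setInd A x := by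
  rw [setInd_apply]
  split_ifs <;> norm_num

/-- "`S` is monotone iff `χ_S` is monotone": the indicator of an up-set is monotone. [cite: LiebSahi2021, §2 before Lemma 2.2 (characteristic functions χ_S; S monotone iff χ_S monotone)] -/
theorem monotone_setInd [Preorder α] {A : Finset α} (hA : IsUpperSet (A : Set α)) : Monotone (setInd A) := by
  intro x y hxy
  by_cases hx : x ∈ A
  · have hy : y ∈ A := hA hxy hx
    simp [setInd_apply, hx, hy]
  · by_cases hy : y ∈ A <;> simp [setInd_apply, hx, hy]

end Indicator

/-! ### Finite layer cake -/

/-- **Finite layer cake.**  On a finite preorder, a pointwise nonnegative monotone `f` is a nonnegative combination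
of indicators of up-sets: `f = Σ_k c_k · 1_{U_k}`, `c_k ≥ 0`, `U_k` up-sets (peel `c = min {f > 0}` times the up-set
`{f > 0}` and induct on the support). [cite: LiebSahi2021, Lemma 2.2 (layer-cake reduction)] -/
theorem exists_upperSet_decomposition [Fintype α] [Preorder α] [DecidableEq α] (f : α → ℝ)
    (hf : ∀ x, 0 ≤ f x) (hm : Monotone f) :
    ∃ l : List (ℝ × Finset α), (∀ p ∈ l, 0 ≤ p.1 ∧ IsUpperSet ((p.2 : Finset α) : Set α)) ∧
      f = (l.map fun p => p.1 • setInd p.2).sum := by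
  -- strong induction on the number of points where `f > 0`
  suffices key : ∀ (N : ℕ) (f : α → ℝ), (∀ x, 0 ≤ f x) → Monotone f →
      (univ.filter fun x => 0 < f x).card ≤ N →
      ∃ l : List (ℝ × Finset α), (∀ p ∈ l, 0 ≤ p.1 ∧ IsUpperSet ((p.2 : Finset α) : Set α)) ∧
        f = (l.map fun p => p.1 • setInd p.2).sum from key _ f hf hm le_rfl
  intro N
  induction N with
  | zero =>
    intro f hf hm hcard
    refine ⟨[], fun p hp => by simp at hp, ?_⟩
    funext x
    have hx : ¬ 0 < f x := by
      intro hpos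
      have hmem : x ∈ univ.filter fun x => 0 < f x := by simp [hpos]
      have := Finset.card_pos.2 ⟨x, hmem⟩
      omega
    simp only [List.map_nil, List.sum_nil, Pi.zero_apply]
    exact le_antisymm (not_lt.1 hx) (hf x)
  | succ N ih =>
    intro f hf hm hcard
    set P : Finset α := univ.filter fun x => 0 < f x with hP
    by_cases hPe : P.Nonempty
    · -- peel the least positive value
      set c : ℝ := P.inf' hPe f with hc
      have hcle : ∀ x ∈ P, c ≤ f x := fun x hx => Finset.inf'_le f hx
      obtain ⟨x₀, hx₀P, hx₀⟩ := Finset.exists_mem_eq_inf' hPe f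
      have hmemP : ∀ x, x ∈ P ↔ 0 < f x := fun x => by simp [hP]
      have hcpos : 0 < c := by rw [hc, hx₀]; exact (hmemP x₀).1 hx₀P
      have hPup : IsUpperSet ((P : Finset α) : Set α) := by
        intro x y hxy hx
        rw [Finset.mem_coe, hmemP] at hx ⊢
        exact lt_of_lt_of_le hx (hm hxy)
      set f' : α → ℝ := f - c • setInd P with hf'
      have hf'P : ∀ x, x ∈ P → f' x = f x - c := fun x hx => by
        simp [hf', setInd_apply, hx]
      have hf'nP : ∀ x, x ∉ P → f' x = f x := fun x hx => by
        simp [hf', setInd_apply, hx]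
      have hfz : ∀ x, x ∉ P → f x = 0 := fun x hx =>
        le_antisymm (not_lt.1 fun h => hx ((hmemP x).2 h)) (hf x)
      have hf'0 : ∀ x, 0 ≤ f' x := by
        intro x
        by_cases hx : x ∈ P
        · rw [hf'P x hx]; linarith [hcle x hx]
        · rw [hf'nP x hx]; exact hf x
      have hf'm : Monotone f' := by
        intro x y hxy
        by_cases hx : x ∈ P
        · have hy : y ∈ P := hPup hxy hx
          rw [hf'P x hx, hf'P y hy]
          linarith [hm hxy]
        · rw [hf'nP x hx, hfz x hx]
          exact hf'0 y
      have hsub : (univ.filter fun x => 0 < f' x) ⊂ P := by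
        rw [Finset.ssubset_iff_subset_ne]
        refine ⟨fun x hx => ?_, fun heq => ?_⟩
        · rw [Finset.mem_filter] at hx
          rw [hmemP]
          by_contra hle
          have hxP : x ∉ P := fun h => hle ((hmemP x).1 h)
          rw [hf'nP x hxP, hfz x hxP] at hx
          exact lt_irrefl _ hx.2
        · have : x₀ ∈ univ.filter fun x => 0 < f' x := heq ▸ hx₀P
          rw [Finset.mem_filter, hf'P x₀ hx₀P, ← hx₀, hc] at this
          linarith [this.2]
      have hcard' : (univ.filter fun x => 0 < f' x).card ≤ N := by
        have := Finset.card_lt_card hsub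
        omega
      obtain ⟨l, hl, hfl⟩ := ih f' hf'0 hf'm hcard'
      refine ⟨(c, P) :: l, fun p hp => ?_, ?_⟩
      · rcases List.mem_cons.1 hp with rfl | hp
        · exact ⟨hcpos.le, hPup⟩
        · exact hl p hp
      · rw [List.map_cons, List.sum_cons, ← hfl, hf']
        abel
    · -- no positive value: `f = 0`
      rw [Finset.not_nonempty_iff_eq_empty] at hPe
      refine ⟨[], fun p hp => by simp at hp, ?_⟩
      funext x
      have hx : ¬ 0 < f x := by
        intro hpos
        have hmem : x ∈ P := by simp [hP, hpos]
        rw [hPe] at hmem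
        simp at hmem
      simp only [List.map_nil, List.sum_nil, Pi.zero_apply]
      exact le_antisymm (not_lt.1 hx) (hf x)

/-! ### `E_n` over a layer-cake sum, and the reduction -/

variable [Fintype α]

/-- Linearity of `E_n` in one slot over a list sum `Σ_k c_k·1_{U_k}`. [cite: Sahi2008, p. 211 (multilinearity)] -/
theorem sahiE_update_listSum [DecidableEq α] (μ : α → ℝ) {n : ℕ} (F : Fin n → α → ℝ) (i : Fin n)
    (l : List (ℝ × Finset α)) :
    sahiE μ n (update F i (l.map fun p => p.1 • setInd p.2).sum) =
      (l.map fun p => p.1 * sahiE μ n (update F i (setInd p.2))).sum := by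
  induction l with
  | nil => simp [sahiE_update_zero]
  | cons p l ih =>
    rw [List.map_cons, List.sum_cons, List.map_cons, List.sum_cons, ← ih]
    have h := sahiE_update_lin μ n F i p.1 1 (setInd p.2) ((l.map fun p => p.1 • setInd p.2).sum)
    rw [one_smul, one_mul] at h
    exact h

/-- The slot-by-slot replacement behind the reduction: if `E_n ≥ 0` on all `n`-tuples of indicators of up-sets,
then `E_n(f) ≥ 0` whenever the slots `≥ m` are already such indicators and the others are nonnegative monotone.
[cite: LiebSahi2021, Lemma 2.2 (layer-cake reduction)] -/
theorem sahiE_nonneg_of_indicators_aux [Preorder α] [DecidableEq α] (μ : α → ℝ) (n : ℕ)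
    (h : ∀ U : Fin n → Finset α, (∀ i, IsUpperSet ((U i : Finset α) : Set α)) →
      0 ≤ sahiE μ n (fun i => setInd (U i))) :
    ∀ (m : ℕ) (f : Fin n → α → ℝ), (∀ i x, 0 ≤ f i x) → (∀ i, Monotone (f i)) →
      (∀ i : Fin n, m ≤ i.val → ∃ U : Finset α, IsUpperSet ((U : Finset α) : Set α) ∧ f i = setInd U) →
      0 ≤ sahiE μ n f
  | 0, f, _, _, hind => by
    choose U hU hfU using fun i => hind i (Nat.zero_le _)
    have hf : f = fun i => setInd (U i) := funext hfU
    rw [hf]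
    exact h U hU
  | m + 1, f, hf, hmono, hind => by
    by_cases hm : m < n
    · let i : Fin n := ⟨m, hm⟩
      obtain ⟨l, hl, hfl⟩ := exists_upperSet_decomposition (f i) (hf i) (hmono i)
      rw [← update_eq_self i f, hfl, sahiE_update_listSum]
      refine List.sum_nonneg fun t ht => ?_
      obtain ⟨p, hp, rfl⟩ := List.mem_map.1 ht
      refine mul_nonneg (hl p hp).1 (sahiE_nonneg_of_indicators_aux μ n h m _ ?_ ?_ ?_)
      · intro j x
        by_cases hji : j = i
        · subst hji; rw [update_self]; exact setInd_nonneg _ _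
        · rw [update_of_ne hji]; exact hf j x
      · intro j
        by_cases hji : j = i
        · subst hji; rw [update_self]; exact monotone_setInd (hl p hp).2
        · rw [update_of_ne hji]; exact hmono j
      · intro j hmj
        by_cases hji : j = i
        · subst hji
          exact ⟨p.2, (hl p hp).2, by rw [update_self]⟩
        · have hij : m + 1 ≤ j.val := by
            have : j.val ≠ m := fun hv => hji (Fin.ext hv)
            omega
          obtain ⟨U, hU, hjU⟩ := hind j hij
          exact ⟨U, hU, by rw [update_of_ne hji]; exact hjU⟩
    · exact sahiE_nonneg_of_indicators_aux μ n h m f hf hmono fun i hi => absurd hi (by omega)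

/-- **Reduction to indicators of up-sets** [LiebSahi2021, Lemma 2.2, discrete form]: for a weight `μ` on a finite
preorder, order-`n` Sahi positivity is equivalent to `E_n(1_{U_0},…,1_{U_{n−1}}) ≥ 0` for all `n`-tuples of
up-sets.  (So Kahn's form of `C_3` — three increasing EVENTS under a product measure [Kahn2022, Conj. 5] — is the
whole of `C_3` for that measure.) [cite: LiebSahi2021, Lemma 2.2 (layer-cake reduction); Kahn2022, Conj. 5] -/
theorem sahiPositive_iff_indicators [Preorder α] [DecidableEq α] (μ : α → ℝ) (n : ℕ) :
    SahiPositive μ n ↔ ∀ U : Fin n → Finset α, (∀ i, IsUpperSet ((U i : Finset α) : Set α)) →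
      0 ≤ sahiE μ n (fun i => setInd (U i)) := by
  constructor
  · intro h U hU
    exact h _ (fun i x => setInd_nonneg _ _) (fun i => monotone_setInd (hU i))
  · intro h f hf hmono
    exact sahiE_nonneg_of_indicators_aux μ n h n f hf hmono fun i hi => absurd hi (by omega)

end Literature.Combinatorics.Sahi2008
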